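import Summits.QuantumFields.YangMills.Theses.BalabanUVNodes
import Literature.MathematicalPhysics.QuantumFieldTheory.Balaban1983to89.Node00.Record13SepCoPH
import Literature.MathematicalPhysics.QuantumFieldTheory.Balaban1983to89.Beta.DriftRemainder

/-!
# Sketch — crux idea `k2-liminf-line` for item stmt-QuantumFields-20543 (`EndpointGivenBR13SepCoPH`)

Ideator seat ym-nodeO-idea-1 (obstruction-first).  NOT a registered skeleton; this file is the
elaborating "First lemma" evidence of the idea card.  YM mass gap (Clay) is NOT proved by any of this;
route R4 closes only the conditional finite-𝕋⁴ rung `BalabanLadder.UV`.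

Content:
* `betaPartialSumsLowerH_of_eventuallyPos_remainderConst` (PROVED, generic): eventual positivity of the
  one-loop numbers `β⁰_{j+1} ≥ b` for `j ≥ k₀` + constant-form remainder `|β¹| ≤ r ≤ b` on the box ⇒ the
  endpoint hypothesis (PS) `BetaPartialSumsLowerH M γ β` with `M = Σ_{j<k₀}(|β⁰_{j+1}| + r)`.
* `endpointExistence_of_eventuallyPos` (PROVED, generic): hence END for forward-generated constructions.
* the two proposed stubs at the Stage-13 record `EventualPosAtRecord13`, `RemContUpperAtRecord13` and the
  kernel-checked composition `EndpointGivenBR13SepCoPH_of_eventualPos` concluding the crux BY NAME.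
-/

noncomputable section

open scoped Matrix.Norms.L2Operator

namespace Summit.QuantumFields.YangMills.Theses.BalabanUVNodes.YmNodeOIdea1

open Literature.MathematicalPhysics.QuantumFieldTheory.Balaban1983to89
open Literature.MathematicalPhysics.QuantumFieldTheory.Balaban1983to89.FlowStep
open Literature.MathematicalPhysics.QuantumFieldTheory.Balaban1983to89.FlowStepRuns
open Literature.MathematicalPhysics.QuantumFieldTheory.Balaban1983to89.DagBinding (EndpointExistence ForwardGenerated)
open Literature.MathematicalPhysics.QuantumFieldTheory.Balaban1983to89.T4Continuum (T4Family)
open Literature.MathematicalPhysics.QuantumFieldTheory.Balaban1983to89.Node00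
open Literature.MathematicalPhysics.QuantumFieldTheory.Balaban1983to89.Beta.RemainderChain (RemainderConst)

/-! ## 1. Generic glue (proved): eventual positivity + constant-form remainder ⇒ (PS) ⇒ END -/

/-- (PS) from EVENTUAL POSITIVITY of the one-loop numbers and a constant-form remainder not exceeding the
eventual lower bound.  No limit, no rate, no slope identification, no value of any `β⁰_{j+1}`. -/
theorem betaPartialSumsLowerH_of_eventuallyPos_remainderConst {β : HBeta} (S : B12Beta.OneLoopSplit β)
    {b r γ : ℝ} {k₀ : ℕ} (hev : ∀ j, k₀ ≤ j → b ≤ S.β0 j) (hrem : RemainderConst S γ r) (hr0 : 0 ≤ r)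
    (hrb : r ≤ b) : ∃ M, 0 ≤ M ∧ BetaPartialSumsLowerH M γ β := by
  set a : ℕ → ℝ := fun j => |S.β0 j| + r with ha
  have ha0 : ∀ j, 0 ≤ a j := fun j => by positivity
  refine ⟨∑ j ∈ Finset.range k₀, a j, Finset.sum_nonneg fun j _ => ha0 j, ?_⟩
  intro g hg k n hkn
  have hterm : ∀ j, -(if j < k₀ then a j else 0) ≤ β j (prefixOf g j) := by
    intro j
    have hp : prefixOf g j ∈ B12Beta.HistBox γ j := fun i => by simpa using hg i
    have h1 := (abs_le.mp (hrem j _ hp)).1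
    rw [S.split j]
    split_ifs with hj
    · have := neg_abs_le (S.β0 j)
      simp only [ha]
      linarith
    · have hb := hev j (not_lt.mp hj)
      linarith
  have key : ∑ j ∈ Finset.Ico k n, (if j < k₀ then a j else 0) ≤ ∑ j ∈ Finset.range k₀, a j := by
    rw [← Finset.sum_filter]
    apply Finset.sum_le_sum_of_subset_of_nonneg
    · intro j hj
      simp only [Finset.mem_filter, Finset.mem_Ico, Finset.mem_range] at hj ⊢
      exact hj.2
    · intro j _ _; exact ha0 j
  calc -(∑ j ∈ Finset.range k₀, a j)
      ≤ -(∑ j ∈ Finset.Ico k n, (if j < k₀ then a j else 0)) := neg_le_neg key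
    _ = ∑ j ∈ Finset.Ico k n, -(if j < k₀ then a j else 0) := by rw [Finset.sum_neg_distrib]
    _ ≤ ∑ j ∈ Finset.Ico k n, β j (prefixOf g j) := Finset.sum_le_sum fun j _ => hterm j

/-- END from eventual positivity + constant-form remainder + (C) + the printed-type upper bound, for
forward-generated constructions — via `FlowStepRuns.endpointExistence_of_partialSums`. -/
theorem endpointExistence_of_eventuallyPos {C : B12.Construction} {β : HBeta} (hgen : ForwardGenerated C β)
    (S : B12Beta.OneLoopSplit β) {b r γ₀ β' : ℝ} {k₀ : ℕ} (hγ₀ : 0 < γ₀)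
    (hev : ∀ j, k₀ ≤ j → b ≤ S.β0 j) (hrem : RemainderConst S γ₀ r) (hr0 : 0 ≤ r) (hrb : r ≤ b)
    (hβ' : 0 ≤ β') (hcont : BetaContH γ₀ β) (hup : BetaUpperH β' γ₀ β) : EndpointExistence C := by
  obtain ⟨M, hM, hps⟩ := betaPartialSumsLowerH_of_eventuallyPos_remainderConst S hev hrem hr0 hrb
  exact endpointExistence_of_partialSums hgen hγ₀ hM hβ' hcont hps hup

/-! ## 2. The proposed stubs at the Stage-13 record and the composition concluding the crux by name -/

/-- proposed STUB 1 «(EP) eventual positivity of the record's one-loop numbers»: for the Stage-13 `SU(2)`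
record, SOME `b > 0` bounds `β⁰_{j+1}` (= `beta0OfMerged … θ.v₀ j`, the one-sided `g ↓ 0` limit of
Bałaban's merged β of record) from below for all `j ≥ k₀`.  Slope `b` UNNAMED, `k₀` non-explicit. -/
def EventualPosAtRecord13 : Prop :=
  ∀ (F : T4Family) (θ : Node00.Stage13HParams F 2) (hP : θ.Provisos₁₃SepCoPH F 2), θ.Admissible F 2 →
    letI := θ.instVβ₁; letI := θ.instVβ₂; letI := θ.instιβ
    ∃ (b : ℝ) (k₀ : ℕ), 0 < b ∧ ∀ j, k₀ ≤ j →
      b ≤ beta0OfMerged (betaMerged F (mergedTermFamilyMatT F 2 (TcanOfRecord F 2) (chiFixed29 F 2 θ.ν θ.ε₂₉) θ.εbg) θ.ρ8 θ.bV) θ.v₀ j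

/-- proposed STUB 2 «(D4-lite) scale-free remainder + (C) + upper bound at the record»: for every `s > 0` some
box `]0, γ₀]`, `0 < γ₀ ≤ θ.γ`, on which the record's definitional remainder `β¹ = 𝟙_box·(β − β⁰)` is `≤ r ≤ s`
in absolute value, the record's β is jointly continuous in the history, and bounded above by some `β' ≥ 0`. -/
def RemContUpperAtRecord13 : Prop :=
  ∀ (F : T4Family) (θ : Node00.Stage13HParams F 2) (hP : θ.Provisos₁₃SepCoPH F 2), θ.Admissible F 2 →
    letI := θ.instVβ₁; letI := θ.instVβ₂; letI := θ.instιβ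
    ∀ s : ℝ, 0 < s → ∃ γ₀ r β' : ℝ, 0 < γ₀ ∧ γ₀ ≤ θ.γ ∧ 0 ≤ r ∧ r ≤ s ∧ 0 ≤ β' ∧
      RemainderConst
        (oneLoopSplit_betaOfMerged (betaMerged F (mergedTermFamilyMatT F 2 (TcanOfRecord F 2) (chiFixed29 F 2 θ.ν θ.ε₂₉) θ.εbg) θ.ρ8 θ.bV)
          (beta0OfMerged (betaMerged F (mergedTermFamilyMatT F 2 (TcanOfRecord F 2) (chiFixed29 F 2 θ.ν θ.ε₂₉) θ.εbg) θ.ρ8 θ.bV) θ.v₀) θ.γ)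
        γ₀ r ∧
      BetaContH γ₀ (Node00.datumOfRecord₁₃SepCoPH F 2 θ hP).βfun ∧
      BetaUpperH β' γ₀ (Node00.datumOfRecord₁₃SepCoPH F 2 θ hP).βfun

/-- THE COMPOSITION (kernel-checked, no sorry): STUB 1 → STUB 2 → the crux `EndpointGivenBR13SepCoPH` BY NAME,
through `endpointExistence_of_eventuallyPos` at the datum of record (`fwd` = the datum's forward generation;
the split = `Node00.oneLoopSplit_betaOfMerged`, definitionally the datum's β).  Like the registered line it does
not use the item's hypotheses (B) and (P6). -/
theorem EndpointGivenBR13SepCoPH_of_eventualPos (h₁ : EventualPosAtRecord13) (h₂ : RemContUpperAtRecord13) :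
    Summit.QuantumFields.YangMills.Theses.BalabanUVNodes.EndpointGivenBR13SepCoPH := by
  intro F θ hP _hU hθ _hB _hwin
  letI := θ.instVβ₁; letI := θ.instVβ₂; letI := θ.instιβ
  obtain ⟨b, k₀, hb, hev⟩ := h₁ F θ hP hθ
  obtain ⟨γ₀, r, β', hγ₀, -, hr0, hrb, hβ', hrem, hcont, hup⟩ := h₂ F θ hP hθ b hb
  exact endpointExistence_of_eventuallyPos (Node00.datumOfRecord₁₃SepCoPH F 2 θ hP).fwd
    (oneLoopSplit_betaOfMerged _ _ _) hγ₀ hev hrem hr0 hrb hβ' hcont hup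

/-! ## 3. Two suppliers of STUB 1 that need NO RATE (typed shapes only; the second needs no limit either) -/

/-- supplier (s1): plain convergence to a positive limit (e.g. `TransferBal` = road FP's identified value +
rate-free (CONV-C-lim)) ⇒ (EP).  [`Beta.Transfer.eventually_ge_half_of_transferBal` is the `stepBal` instance.] -/
theorem eventualPos_of_tendsto_pos {b : ℕ → ℝ} {B : ℝ} (h : Filter.Tendsto b Filter.atTop (nhds B)) (hB : 0 < B) :
    ∃ (c : ℝ) (k₀ : ℕ), 0 < c ∧ ∀ j, k₀ ≤ j → c ≤ b j := by
  have hev : ∀ᶠ k in Filter.atTop, B / 2 < b k := h.eventually (eventually_gt_nhds (by linarith))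
  obtain ⟨k₀, hk₀⟩ := Filter.eventually_atTop.mp hev
  exact ⟨B / 2, k₀, by positivity, fun j hj => (hk₀ j hj).le⟩

/-- supplier (s2): ISOTONE + ONE CERTIFIED ANCHOR ⇒ (EP) — no limit, no identification of any value:
`β⁰_{j+2} ≥ β⁰_{j+1}` for `j ≥ j₀` (a POSITED monotonicity of β⁰ itself — NOT gan24-p4's energy isotonicity, which does not imply it) and ONE certified number `β⁰_{j₀+1} > 0`
(CAP an5 row `k = j₀`). -/
theorem eventualPos_of_monotone_anchor {b : ℕ → ℝ} {j₀ : ℕ} (hmono : ∀ j, j₀ ≤ j → b j ≤ b (j + 1))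
    (hanchor : 0 < b j₀) : ∃ (c : ℝ) (k₀ : ℕ), 0 < c ∧ ∀ j, k₀ ≤ j → c ≤ b j := by
  refine ⟨b j₀, j₀, hanchor, fun j hj => ?_⟩
  induction j, hj using Nat.le_induction with
  | base => exact le_rfl
  | succ n hn ih => exact ih.trans (hmono n hn)

end Summit.QuantumFields.YangMills.Theses.BalabanUVNodes.YmNodeOIdea1

end
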